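/-
Copyright (c) 2026 the pub-hodgecm-mathlib formalisation cell (harness21).  Prover seat hodgecm-mathlib-F0P3a-p05 (g18): road «S3-ram» (LEAD F0P3a-plan (g13); owner∕table
F0P3a-p06 (g15); (Cnt2′) chair F0P3a-p07 (g14)), ROW-1C IN RANK 2 — part 1: the residual tools (rank-2 residual algebra; dimension-generic residue reading); 2026-09-02.
-/
import Literature.NumberTheory.Automorphic.UnitaryLatticeTreeRankOneVertexOneClassRamified   -- ★ ROW-1C rank 3 (this lineage, g17): brings ★ G3⁗ `exists_unit_v_sub_mul_sq_lt_one_iff_residue`, `residue_map_sigma_eq`, `map_coe_mem_integer`, ★ `residue_eq_zero_iff_v_lt_one`, `residue_eq_of_v_sub_lt_one`, ★ K∕I `v_sigma_add_self_le_of_odd`, `v_sigma_sub_self_le_of_even`, ★ `mem_mapGL_iff`, `pairing_mulVec_mulVec_of_mem_unitary`, `quadraticChar`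
import Literature.NumberTheory.Automorphic.UnitaryTwoCartanAnyInvolution                    -- ★ `UnitaryGroup.Two.antidiagonal_two_over_eq` (`Φ₂ = !![0,1;1,0]`)
import HarnessLib

/-!
# Rank-one vertices at a tamely ramified place — the RESIDUAL TOOLS: the `2 × 2` residual algebra of a `J`-symmetric matrix of square zero, and the dimension-generic
# passage from depth tokens to the residual matrix (Bruhat–Tits 1972 §10; Tits 1979 §3.5; Kottwitz 1986 §3; Rogawski 1990 §4.9)

Topic `NumberTheory/Automorphic`; namespace `Literature.NumberTheory.Automorphic.UnitaryLatticeTree`.  THEOREMS ONLY (no definition, no instance, no notation, no named fact,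
no `sorry`); kernel lane `--supports stmt-HodgeConjecture-24833`.  Cell `pub/hodgecm-mathlib` (D-0151), crux H413; road «S3-ram» (Literature seeding, count-neutral), the (T2)
G-side organ (Cnt2′) of F0P3a-p07 (g14): part 1 of **ROW-1C IN RANK 2** (the W-side rank-one class dichotomy, file `UnitaryLatticeTreeRankOneVertexOneClassTwoRamified`), the
rank-2 port of this lineage's ★ ROW-1C (rank 3, `UnitaryLatticeTreeRankOneVertexOneClassRamified`) with the dimension-generic steps now stated for every `N` (antidiagonal
form `J_N = antidiag(1,…,1)`; datum `σ` valuation-preserving, `σϖ = −ϖ`, residually trivial, `|2| = 1`):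

* §1 (residual algebra over a field `F`, `2 ≠ 0`): a `J`-symmetric `2 × 2` matrix `Ȳ` (`Ȳ₀₀ = Ȳ₁₁`) of square zero has ZERO DIAGONAL and `Ȳ₀₁·Ȳ₁₀ = 0`
  (`diag_eq_zero_of_symm_of_mul_self_eq_zero_two`); its form `ᵗx̄(J̄Ȳ)x̄ = Ȳ₁₀x̄₀² + Ȳ₀₁x̄₁²` (`dotProduct_antidiagonal_two_mul_mulVec`) has ONE non-zero coefficient `s₀` when
  `Ȳ ≠ 0`, so it represents exactly the square class of `s₀` (`exists_forall_represents_iff_of_symm_of_mul_self_eq_zero_two`), whence the `c ∕ c·ε` dichotomy over a finite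
  field (`represents_xor_represents_mul_of_symm_of_mul_self_eq_zero_two`, `quadraticChar` multiplicative).
* §2 (valuation → residue, any rank `N`): the integral leading matrix `Y₀ = ϖ^{−d}M` (`exists_integer_matrix_eq_inv_pow_mul_fin`), `LEV₂ ⇒ Ȳ² = 0`
  (`map_residue_mul_self_eq_zero_of_sq_le_fin`), exact depth ⇒ `Ȳ ≠ 0` (`map_residue_ne_zero_of_not_forall_le_succ_fin`), the UNITARITY RELATION
  `|Y_{ij} + σ(Y_{rev j,rev i})| ≤ |ϖ|^{2d}` for `Γ ∈ U(σ, J_N)` (`v_coe_sub_one_apply_add_sigma_rev_le_fin`) and its residual shadows — SYMMETRY at odd `d`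
  (`v_coe_sub_one_apply_sub_rev_le_of_odd_fin`, `map_residue_apply_eq_rev_of_sub_le_fin`), ANTISYMMETRY at even `d` (`v_coe_sub_one_apply_add_rev_le_of_even_fin`,
  `map_residue_apply_eq_neg_rev_of_add_le_fin`); the class token at `u·L₀` is the class token at `L₀` for `u⁻¹Γu` (`exists_mem_mapGL_stdLattice_depthClass_iff_fin`, any form).

HONEST LABEL: HC_CM is proved only modulo the 2 remaining named inputs (hLiu418 24832, h413 24833) until rung 0 closes; nothing printed is asserted here (elementary algebra over a
valuation ring and a finite field); «S3-ram» has no books consequence.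

## References
* [BruhatTits1972] F. Bruhat, J. Tits, *Groupes réductifs sur un corps local I*, Publ. Math. IHÉS 41 (1972), §10 (vertex stabilisers, congruence filtration, residual forms).
* [Tits1979] J. Tits, *Reductive groups over local fields*, PSPM 33.1 (1979), §3.5 (filtration quotients of a parahoric of a ramified unitary group).
* [Kottwitz1986] R. E. Kottwitz, *Base change for unit elements of Hecke algebras*, Compositio Math. 60 (1986), §3 (counting fixed lattices by residual data).
* [Rogawski1990] J. D. Rogawski, *Automorphic Representations of Unitary Groups in Three Variables*, Ann. of Math. Stud. 123 (1990), §4.9 pp. 54–55 (the two rank-one classes).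
* [Serre1980Trees] J.-P. Serre, *Trees* (1980), Ch. II §1.1 (lattices, levels, the residual reading).
* [IrelandRosen1990] K. Ireland, M. Rosen, *A Classical Introduction to Modern Number Theory*, 2nd ed. (1990), Ch. 5 §1 (quadratic residues; `χ` multiplicative).
-/

set_option autoImplicit false

noncomputable section

open scoped Valued WithZero Matrix MatrixGroups

namespace Literature.NumberTheory.Automorphic.UnitaryLatticeTree

open Literature.NumberTheory.Automorphic Literature.NumberTheory.Automorphic.HermitianLattice

/-! ## §1 Residual algebra over a field, rank 2 -/

section Residual

variable {F : Type*} [Field F]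

/-- `ᵗz J̄ v = Σ_i z_i v_{rev i}` on `F²`. [cite: BruhatTits1972, §10] -/
theorem dotProduct_antidiagonal_two_mulVec_eq_sum (z v : Fin 2 → F) :
    z ⬝ᵥ (((StdForm.antidiagonal 2).over F) *ᵥ v) = ∑ i, z i * v (Fin.rev i) := by
  rw [UnitaryGroup.Two.antidiagonal_two_over_eq]
  simp [Matrix.mulVec, dotProduct, Fin.sum_univ_two]

/-- The form of `J̄Ȳ` in rank 2: `ᵗx̄ (J̄Ȳ) x̄ = x̄₀(Ȳ₁₀x̄₀ + Ȳ₁₁x̄₁) + x̄₁(Ȳ₀₀x̄₀ + Ȳ₀₁x̄₁)`. [cite: BruhatTits1972, §10] -/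
theorem dotProduct_antidiagonal_two_mul_mulVec (Y : Matrix (Fin 2) (Fin 2) F) (x : Fin 2 → F) :
    x ⬝ᵥ ((((StdForm.antidiagonal 2).over F) * Y) *ᵥ x) = x 0 * (Y 1 0 * x 0 + Y 1 1 * x 1) + x 1 * (Y 0 0 * x 0 + Y 0 1 * x 1) := by
  rw [← Matrix.mulVec_mulVec, dotProduct_antidiagonal_two_mulVec_eq_sum]
  simp [Matrix.mulVec, dotProduct, Fin.sum_univ_two]

/-- **A `J`-SYMMETRIC `2 × 2` MATRIX OF SQUARE ZERO HAS ZERO DIAGONAL** (`2 ≠ 0`): `Ȳ₀₀ = Ȳ₁₁` and `Ȳ² = 0` give `2Ȳ₀₀Ȳ₀₁ = 2Ȳ₀₀Ȳ₁₀ = 0` and `Ȳ₀₀² + Ȳ₀₁Ȳ₁₀ = 0`, whence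
`Ȳ₀₀ = Ȳ₁₁ = 0` and `Ȳ₀₁Ȳ₁₀ = 0`. [cite: BruhatTits1972, §10] [cite: Tits1979, §3.5] -/
theorem diag_eq_zero_of_symm_of_mul_self_eq_zero_two (h2 : (2 : F) ≠ 0) (Y : Matrix (Fin 2) (Fin 2) F) (hsymm : ∀ i j, Y i j = Y j.rev i.rev) (hsq : Y * Y = 0) :
    Y 0 0 = 0 ∧ Y 1 1 = 0 ∧ Y 0 1 * Y 1 0 = 0 := by
  have hr1 : (1 : Fin 2).rev = 0 := rfl
  have hdd : Y 1 1 = Y 0 0 := by have h := hsymm 1 1; rw [hr1] at h; exact h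
  have e : ∀ i j, Y i 0 * Y 0 j + Y i 1 * Y 1 j = 0 := fun i j => by
    have h := congr_fun (congr_fun hsq i) j
    rwa [Matrix.mul_apply, Fin.sum_univ_two, Matrix.zero_apply] at h
  have h01 : Y 0 0 * Y 0 1 = 0 := by
    have h : (2 : F) * (Y 0 0 * Y 0 1) = 0 := by have h' := e 0 1; rw [hdd] at h'; linear_combination h'
    exact (mul_eq_zero.1 h).resolve_left h2
  have h10 : Y 0 0 * Y 1 0 = 0 := by
    have h : (2 : F) * (Y 0 0 * Y 1 0) = 0 := by have h' := e 1 0; rw [hdd] at h'; linear_combination h'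
    exact (mul_eq_zero.1 h).resolve_left h2
  have h00 : Y 0 0 = 0 := by
    by_contra hne
    have a : Y 0 1 = 0 := (mul_eq_zero.1 h01).resolve_left hne
    have h' := e 0 0
    rw [a, zero_mul, add_zero] at h'
    exact hne (mul_self_eq_zero.1 h')
  refine ⟨h00, hdd.trans h00, ?_⟩
  have h' := e 0 0
  rwa [h00, mul_zero, zero_add] at h'

/-- **The quadratic form of a non-zero `J`-symmetric `2 × 2` `Ȳ` of square zero takes exactly ONE square class of non-zero values** (`2 ≠ 0`): there is `s₀ ≠ 0` (the non-zero
off-diagonal entry) with «`t·(Fˣ)²` is represented» iff «`s₀·t` is a non-zero square», for every `t ≠ 0`. [cite: BruhatTits1972, §10] [cite: Tits1979, §3.5] -/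
theorem exists_forall_represents_iff_of_symm_of_mul_self_eq_zero_two (h2 : (2 : F) ≠ 0) (Y : Matrix (Fin 2) (Fin 2) F) (hsymm : ∀ i j, Y i j = Y j.rev i.rev) (hsq : Y * Y = 0)
    (hne : Y ≠ 0) :
    ∃ s₀ : F, s₀ ≠ 0 ∧ ∀ t : F, t ≠ 0 →
      ((∃ x : Fin 2 → F, ∃ a : F, a ≠ 0 ∧ x ⬝ᵥ ((((StdForm.antidiagonal 2).over F) * Y) *ᵥ x) = t * a ^ 2) ↔ ∃ z : F, z ≠ 0 ∧ s₀ * t = z ^ 2) := by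
  obtain ⟨h00, h11, hprod⟩ := diag_eq_zero_of_symm_of_mul_self_eq_zero_two h2 Y hsymm hsq
  have hform : ∀ x : Fin 2 → F, x ⬝ᵥ ((((StdForm.antidiagonal 2).over F) * Y) *ᵥ x) = Y 1 0 * x 0 ^ 2 + Y 0 1 * x 1 ^ 2 := fun x => by
    rw [dotProduct_antidiagonal_two_mul_mulVec, h00, h11]; ring
  simp only [hform]
  by_cases h10 : Y 1 0 = 0
  · -- then `Y₀₁ ≠ 0` is the coefficient
    have h01 : Y 0 1 ≠ 0 := by
      intro h01
      apply hne
      ext i j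
      fin_cases i <;> fin_cases j
      · exact h00
      · exact h01
      · exact h10
      · exact h11
    refine ⟨Y 0 1, h01, fun t ht => ⟨?_, ?_⟩⟩
    · rintro ⟨x, a, ha, hq⟩
      rw [h10, zero_mul, zero_add] at hq
      refine ⟨Y 0 1 * x 1 / a, ?_, ?_⟩
      · refine div_ne_zero (mul_ne_zero h01 fun hx => ?_) ha
        rw [hx, zero_pow two_ne_zero, mul_zero] at hq
        exact (mul_ne_zero ht (pow_ne_zero 2 ha)) hq.symm
      · rw [div_pow, show (Y 0 1 * x 1) ^ 2 = Y 0 1 * (Y 0 1 * x 1 ^ 2) by ring, hq, mul_div_assoc, mul_div_cancel_right₀ t (pow_ne_zero 2 ha)]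
    · rintro ⟨z, hz, hzt⟩
      refine ⟨Pi.single 1 (z / Y 0 1), 1, one_ne_zero, ?_⟩
      simp only [Pi.single_eq_same, Pi.single_eq_of_ne (show (0 : Fin 2) ≠ 1 by decide), zero_pow two_ne_zero, mul_zero, zero_add, one_pow, mul_one, div_pow]
      rw [← hzt]
      field_simp
  · -- then `Y₁₀ ≠ 0` is the coefficient and `Y₀₁ = 0`
    have h01 : Y 0 1 = 0 := (mul_eq_zero.1 hprod).resolve_right h10
    refine ⟨Y 1 0, h10, fun t ht => ⟨?_, ?_⟩⟩
    · rintro ⟨x, a, ha, hq⟩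
      rw [h01, zero_mul, add_zero] at hq
      refine ⟨Y 1 0 * x 0 / a, ?_, ?_⟩
      · refine div_ne_zero (mul_ne_zero h10 fun hx => ?_) ha
        rw [hx, zero_pow two_ne_zero, mul_zero] at hq
        exact (mul_ne_zero ht (pow_ne_zero 2 ha)) hq.symm
      · rw [div_pow, show (Y 1 0 * x 0) ^ 2 = Y 1 0 * (Y 1 0 * x 0 ^ 2) by ring, hq, mul_div_assoc, mul_div_cancel_right₀ t (pow_ne_zero 2 ha)]
    · rintro ⟨z, hz, hzt⟩
      refine ⟨Pi.single 0 (z / Y 1 0), 1, one_ne_zero, ?_⟩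
      simp only [Pi.single_eq_same, Pi.single_eq_of_ne (show (1 : Fin 2) ≠ 0 by decide), zero_pow two_ne_zero, mul_zero, add_zero, one_pow, mul_one, div_pow]
      rw [← hzt]
      field_simp

/-- **THE SQUARE-CLASS DICHOTOMY OVER A FINITE FIELD, RANK 2** (`2 ≠ 0`): for `c ≠ 0` and a non-square `ε`, exactly one of «`c·(𝓀ˣ)²` is taken», «`cε·(𝓀ˣ)²` is taken» holds
for the form of a non-zero `J`-symmetric `Ȳ` of square zero. [cite: Rogawski1990, §4.9 p. 55] [cite: Kottwitz1986, §3] [cite: IrelandRosen1990, Ch. 5 §1] -/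
theorem represents_xor_represents_mul_of_symm_of_mul_self_eq_zero_two [Finite F] (h2 : (2 : F) ≠ 0) (Y : Matrix (Fin 2) (Fin 2) F)
    (hsymm : ∀ i j, Y i j = Y j.rev i.rev) (hsq : Y * Y = 0) (hne : Y ≠ 0) {c ε : F} (hc : c ≠ 0) (hε : ¬ IsSquare ε) :
    ((∃ x : Fin 2 → F, ∃ a : F, a ≠ 0 ∧ x ⬝ᵥ ((((StdForm.antidiagonal 2).over F) * Y) *ᵥ x) = c * a ^ 2) ∨
        (∃ x : Fin 2 → F, ∃ a : F, a ≠ 0 ∧ x ⬝ᵥ ((((StdForm.antidiagonal 2).over F) * Y) *ᵥ x) = (c * ε) * a ^ 2)) ∧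
      ¬ ((∃ x : Fin 2 → F, ∃ a : F, a ≠ 0 ∧ x ⬝ᵥ ((((StdForm.antidiagonal 2).over F) * Y) *ᵥ x) = c * a ^ 2) ∧
        (∃ x : Fin 2 → F, ∃ a : F, a ≠ 0 ∧ x ⬝ᵥ ((((StdForm.antidiagonal 2).over F) * Y) *ᵥ x) = (c * ε) * a ^ 2)) := by
  classical
  haveI : Fintype F := Fintype.ofFinite F
  have hε0 : ε ≠ 0 := fun h => hε (h ▸ IsSquare.zero)
  obtain ⟨s₀, hs₀, hrep⟩ := exists_forall_represents_iff_of_symm_of_mul_self_eq_zero_two h2 Y hsymm hsq hne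
  rw [hrep c hc, hrep (c * ε) (mul_ne_zero hc hε0)]
  have key : ∀ t : F, t ≠ 0 → ((∃ z : F, z ≠ 0 ∧ t = z ^ 2) ↔ IsSquare t) := by
    intro t ht
    constructor
    · rintro ⟨z, -, rfl⟩; exact ⟨z, by ring⟩
    · rintro ⟨z, rfl⟩
      refine ⟨z, fun h0 => ht (by rw [h0, mul_zero]), by ring⟩
  have key' : ∀ t : F, t ≠ 0 → ((∃ z : F, z ≠ 0 ∧ t = z ^ 2) ↔ (∃ z : F, z ≠ 0 ∧ t = z ^ 2)) := fun _ _ => Iff.rfl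
  have swap : ∀ t : F, (∃ z : F, z ≠ 0 ∧ s₀ * t = z ^ 2) ↔ (∃ z : F, z ≠ 0 ∧ s₀ * t = z ^ 2) := fun _ => Iff.rfl
  rw [key _ (mul_ne_zero hs₀ hc), key _ (mul_ne_zero hs₀ (mul_ne_zero hc hε0))]
  have hχε : quadraticChar F ε = -1 := (quadraticChar_neg_one_iff_not_isSquare).2 hε
  constructor
  · by_cases hsc : IsSquare (s₀ * c)
    · exact Or.inl hsc
    · right
      rw [← quadraticChar_one_iff_isSquare (mul_ne_zero hs₀ (mul_ne_zero hc hε0)), ← mul_assoc, map_mul,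
        (quadraticChar_neg_one_iff_not_isSquare).2 hsc, hχε]
      norm_num
  · rintro ⟨h1, h2'⟩
    rw [← quadraticChar_one_iff_isSquare (mul_ne_zero hs₀ hc)] at h1
    rw [← quadraticChar_one_iff_isSquare (mul_ne_zero hs₀ (mul_ne_zero hc hε0)), ← mul_assoc, map_mul, h1, hχε] at h2'
    norm_num at h2'

end Residual


variable {K : Type*} [Field K] [Valued K ℤᵐ⁰] {σ : K →+* K} {ϖ : K}

/-! ## §2 From the depth-`d` tokens (valuation level) to the residual matrix — the dimension-generic steps in any rank `N` -/

/-- The leading matrix `Y₀ = ϖ^{−d}·M` is integral when `|M_{ij}| ≤ |ϖ|^d` (any rank). [cite: Tits1979, §3.5] [cite: Kottwitz1986, §3] -/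
theorem exists_integer_matrix_eq_inv_pow_mul_fin {N : ℕ} (hϖ : Valued.v ϖ = WithZero.exp (-1 : ℤ)) {d : ℕ} (M : Matrix (Fin N) (Fin N) K)
    (hM : ∀ i j, Valued.v (M i j) ≤ Valued.v ϖ ^ d) :
    ∃ Y₀ : Matrix (Fin N) (Fin N) 𝒪[K], ∀ i j, ((Y₀ i j : 𝒪[K]) : K) = (ϖ ^ d)⁻¹ * M i j := by
  have hϖ0 : ϖ ≠ 0 := fun h0 => by rw [h0, map_zero] at hϖ; exact WithZero.coe_ne_zero hϖ.symm
  have hvϖ0 : Valued.v ϖ ≠ 0 := (Valuation.ne_zero_iff _).2 hϖ0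
  have hint : ∀ i j, Valued.v ((ϖ ^ d)⁻¹ * M i j) ≤ 1 := fun i j => by
    rw [map_mul, map_inv₀, map_pow]
    calc (Valued.v ϖ ^ d)⁻¹ * Valued.v (M i j) ≤ (Valued.v ϖ ^ d)⁻¹ * Valued.v ϖ ^ d := mul_le_mul' le_rfl (hM i j)
      _ = 1 := inv_mul_cancel₀ (pow_ne_zero _ hvϖ0)
  exact ⟨fun i j => ⟨(ϖ ^ d)⁻¹ * M i j, (Valuation.mem_integer_iff _ _).2 (hint i j)⟩, fun i j => rfl⟩

/-- **`LEV₂ (ϖ^{2d+1})` ⇒ `Ȳ² = 0`** (any rank): if `|(M²)_{ij}| ≤ |ϖ|^{2d+1}` then the residual leading matrix has square zero. [cite: Tits1979, §3.5] [cite: Kottwitz1986, §3] -/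
theorem map_residue_mul_self_eq_zero_of_sq_le_fin {N : ℕ} (hϖ : Valued.v ϖ = WithZero.exp (-1 : ℤ)) {d : ℕ} (M : Matrix (Fin N) (Fin N) K) (Y₀ : Matrix (Fin N) (Fin N) 𝒪[K])
    (hY₀ : ∀ i j, ((Y₀ i j : 𝒪[K]) : K) = (ϖ ^ d)⁻¹ * M i j) (hsq : ∀ i j, Valued.v ((M * M) i j) ≤ Valued.v ϖ ^ (2 * d + 1)) :
    Y₀.map (IsLocalRing.residue 𝒪[K]) * Y₀.map (IsLocalRing.residue 𝒪[K]) = 0 := by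
  have hϖ0 : ϖ ≠ 0 := fun h0 => by rw [h0, map_zero] at hϖ; exact WithZero.coe_ne_zero hϖ.symm
  have hvϖ0 : Valued.v ϖ ≠ 0 := (Valuation.ne_zero_iff _).2 hϖ0
  have hϖlt : Valued.v ϖ < 1 := by rw [hϖ, ← WithZero.exp_zero]; exact WithZero.exp_lt_exp.2 (by norm_num)
  rw [← Matrix.map_mul]
  ext i j
  rw [Matrix.map_apply, Matrix.zero_apply, residue_eq_zero_iff_v_lt_one]
  have hcoe : (((Y₀ * Y₀) i j : 𝒪[K]) : K) = (ϖ ^ d)⁻¹ * ((ϖ ^ d)⁻¹ * (M * M) i j) := by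
    rw [Matrix.mul_apply, Matrix.mul_apply]
    push_cast
    simp only [hY₀, Finset.mul_sum]
    exact Finset.sum_congr rfl fun k _ => by ring
  have hbd : Valued.v ((M * M) i j) ≤ Valued.v ϖ ^ d * (Valued.v ϖ ^ d * Valued.v ϖ) := by
    have h := hsq i j
    rwa [pow_succ, two_mul, pow_add, mul_assoc] at h
  rw [hcoe, map_mul, map_mul, map_inv₀, map_pow]
  calc (Valued.v ϖ ^ d)⁻¹ * ((Valued.v ϖ ^ d)⁻¹ * Valued.v ((M * M) i j))
      ≤ (Valued.v ϖ ^ d)⁻¹ * ((Valued.v ϖ ^ d)⁻¹ * (Valued.v ϖ ^ d * (Valued.v ϖ ^ d * Valued.v ϖ))) := mul_le_mul' le_rfl (mul_le_mul' le_rfl hbd)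
    _ = Valued.v ϖ := by rw [inv_mul_cancel_left₀ (pow_ne_zero _ hvϖ0), inv_mul_cancel_left₀ (pow_ne_zero _ hvϖ0)]
    _ < 1 := hϖlt

/-- **Symmetry one order down ⇒ `Ȳ` is `J`-symmetric** (any rank): if `|M_{ij} − M_{rev j, rev i}| ≤ |ϖ|^{d+1}` then `Ȳ_{ij} = Ȳ_{rev j, rev i}`. [cite: Tits1979, §3.5] [cite: BruhatTits1972, §10] -/
theorem map_residue_apply_eq_rev_of_sub_le_fin {N : ℕ} (hϖ : Valued.v ϖ = WithZero.exp (-1 : ℤ)) {d : ℕ} (M : Matrix (Fin N) (Fin N) K) (Y₀ : Matrix (Fin N) (Fin N) 𝒪[K])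
    (hY₀ : ∀ i j, ((Y₀ i j : 𝒪[K]) : K) = (ϖ ^ d)⁻¹ * M i j) (hsymm : ∀ i j, Valued.v (M i j - M j.rev i.rev) ≤ Valued.v ϖ ^ (d + 1)) (i j : Fin N) :
    Y₀.map (IsLocalRing.residue 𝒪[K]) i j = Y₀.map (IsLocalRing.residue 𝒪[K]) j.rev i.rev := by
  have hϖ0 : ϖ ≠ 0 := fun h0 => by rw [h0, map_zero] at hϖ; exact WithZero.coe_ne_zero hϖ.symm
  have hvϖ0 : Valued.v ϖ ≠ 0 := (Valuation.ne_zero_iff _).2 hϖ0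
  have hϖlt : Valued.v ϖ < 1 := by rw [hϖ, ← WithZero.exp_zero]; exact WithZero.exp_lt_exp.2 (by norm_num)
  rw [Matrix.map_apply, Matrix.map_apply]
  apply residue_eq_of_v_sub_lt_one
  rw [hY₀, hY₀, ← mul_sub, map_mul, map_inv₀, map_pow]
  calc (Valued.v ϖ ^ d)⁻¹ * Valued.v (M i j - M j.rev i.rev) ≤ (Valued.v ϖ ^ d)⁻¹ * (Valued.v ϖ ^ d * Valued.v ϖ) :=
        mul_le_mul' le_rfl (by rw [← pow_succ]; exact hsymm i j)
    _ = Valued.v ϖ := by rw [inv_mul_cancel_left₀ (pow_ne_zero _ hvϖ0)]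
    _ < 1 := hϖlt

/-- **Antisymmetry one order down ⇒ `Ȳ` is `J`-antisymmetric** (any rank): if `|M_{ij} + M_{rev j, rev i}| ≤ |ϖ|^{d+1}` then `Ȳ_{ij} = −Ȳ_{rev j, rev i}`.
[cite: Tits1979, §3.5] [cite: BruhatTits1972, §10] -/
theorem map_residue_apply_eq_neg_rev_of_add_le_fin {N : ℕ} (hϖ : Valued.v ϖ = WithZero.exp (-1 : ℤ)) {d : ℕ} (M : Matrix (Fin N) (Fin N) K) (Y₀ : Matrix (Fin N) (Fin N) 𝒪[K])
    (hY₀ : ∀ i j, ((Y₀ i j : 𝒪[K]) : K) = (ϖ ^ d)⁻¹ * M i j) (hanti : ∀ i j, Valued.v (M i j + M j.rev i.rev) ≤ Valued.v ϖ ^ (d + 1)) (i j : Fin N) :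
    Y₀.map (IsLocalRing.residue 𝒪[K]) i j = -Y₀.map (IsLocalRing.residue 𝒪[K]) j.rev i.rev := by
  have hϖ0 : ϖ ≠ 0 := fun h0 => by rw [h0, map_zero] at hϖ; exact WithZero.coe_ne_zero hϖ.symm
  have hvϖ0 : Valued.v ϖ ≠ 0 := (Valuation.ne_zero_iff _).2 hϖ0
  have hϖlt : Valued.v ϖ < 1 := by rw [hϖ, ← WithZero.exp_zero]; exact WithZero.exp_lt_exp.2 (by norm_num)
  rw [Matrix.map_apply, Matrix.map_apply, ← map_neg]
  apply residue_eq_of_v_sub_lt_one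
  push_cast
  rw [sub_neg_eq_add, hY₀, hY₀, ← mul_add, map_mul, map_inv₀, map_pow]
  calc (Valued.v ϖ ^ d)⁻¹ * Valued.v (M i j + M j.rev i.rev) ≤ (Valued.v ϖ ^ d)⁻¹ * (Valued.v ϖ ^ d * Valued.v ϖ) :=
        mul_le_mul' le_rfl (by rw [← pow_succ]; exact hanti i j)
    _ = Valued.v ϖ := by rw [inv_mul_cancel_left₀ (pow_ne_zero _ hvϖ0)]
    _ < 1 := hϖlt

/-- **Exact depth `d` ⇒ `Ȳ ≠ 0`** (any rank): if NOT all `|M_{ij}| ≤ |ϖ|^{d+1}` then the residual leading matrix is non-zero (discreteness of the valuation).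
[cite: Serre1980Trees, Ch. II §1.1] [cite: Kottwitz1986, §3] -/
theorem map_residue_ne_zero_of_not_forall_le_succ_fin {N : ℕ} (hϖ : Valued.v ϖ = WithZero.exp (-1 : ℤ)) {d : ℕ} (M : Matrix (Fin N) (Fin N) K) (Y₀ : Matrix (Fin N) (Fin N) 𝒪[K])
    (hY₀ : ∀ i j, ((Y₀ i j : 𝒪[K]) : K) = (ϖ ^ d)⁻¹ * M i j) (hne : ¬ ∀ i j, Valued.v (M i j) ≤ Valued.v ϖ ^ (d + 1)) :
    Y₀.map (IsLocalRing.residue 𝒪[K]) ≠ 0 := by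
  have hϖ0 : ϖ ≠ 0 := fun h0 => by rw [h0, map_zero] at hϖ; exact WithZero.coe_ne_zero hϖ.symm
  have hvϖ0 : Valued.v ϖ ≠ 0 := (Valuation.ne_zero_iff _).2 hϖ0
  intro h0
  apply hne
  intro i j
  have hij : IsLocalRing.residue 𝒪[K] (Y₀ i j) = 0 := by
    have h := congr_fun (congr_fun h0 i) j
    rwa [Matrix.map_apply, Matrix.zero_apply] at h
  rw [residue_eq_zero_iff_v_lt_one, hY₀] at hij
  have h1 : (1 : ℤᵐ⁰) = Valued.v ϖ * WithZero.exp (1 : ℤ) := by rw [hϖ, ← WithZero.exp_add]; norm_num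
  rw [h1] at hij
  have hle := (WithZero.lt_mul_exp_iff_le hvϖ0).1 hij
  rw [map_mul, map_inv₀, map_pow] at hle
  have h := mul_le_mul' (le_refl (Valued.v ϖ ^ d)) hle
  rwa [mul_inv_cancel_left₀ (pow_ne_zero _ hvϖ0), ← pow_succ] at h

/-- **THE UNITARITY RELATION ONE ORDER DOWN** (any rank `N`, antidiagonal form `J_N`): for `Γ ∈ U(σ, J_N)` with `Y = Γ − 1` of level `ϖ^d`,
**`|Y_{ij} + σ(Y_{rev j, rev i})| ≤ |ϖ|^d·|ϖ|^d`** — from `B₀(Γu, Γv) = B₀(u, v)` at `u = e_{rev i}`, `v = e_j`: `Y_{ij} + σ(Y_{rev j, rev i}) = −B₀(Ye_{rev i}, Ye_j)`.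
(The rank-3 instance is ★ `v_coe_sub_one_apply_add_sigma_rev_le`.) [cite: Tits1979, §3.5] [cite: BruhatTits1972, §10] -/
theorem v_coe_sub_one_apply_add_sigma_rev_le_fin {N : ℕ} (hvσ : ∀ z, Valued.v (σ z) = Valued.v z)
    (γ : unitaryGroupOfForm σ ((StdForm.antidiagonal N).over K)) {d : ℕ}
    (hY : ∀ i j, Valued.v ((((γ : GL (Fin N) K) : Matrix (Fin N) (Fin N) K) - 1) i j) ≤ Valued.v ϖ ^ d) (i j : Fin N) :
    Valued.v ((((γ : GL (Fin N) K) : Matrix (Fin N) (Fin N) K) - 1) i j + σ ((((γ : GL (Fin N) K) : Matrix (Fin N) (Fin N) K) - 1) j.rev i.rev)) ≤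
      Valued.v ϖ ^ d * Valued.v ϖ ^ d := by
  set Y : Matrix (Fin N) (Fin N) K := ((γ : GL (Fin N) K) : Matrix (Fin N) (Fin N) K) - 1 with hYdef
  have hγu := (mem_unitaryGroupOfForm_antidiagonal_iff (γ : GL (Fin N) K)).1 γ.2
  have hγY : ((γ : GL (Fin N) K) : Matrix (Fin N) (Fin N) K) = 1 + Y := by rw [hYdef, add_sub_cancel]
  have hexp : ∀ u v : Fin N → K, B₀ σ N u (Y.mulVec v) + B₀ σ N (Y.mulVec u) v = -B₀ σ N (Y.mulVec u) (Y.mulVec v) := by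
    intro u v
    have h := hγu u v
    rw [hγY, Matrix.add_mulVec, Matrix.add_mulVec, Matrix.one_mulVec, Matrix.one_mulVec, map_add, map_add, LinearMap.add_apply, LinearMap.add_apply] at h
    have h' : B₀ σ N u (Y.mulVec v) + B₀ σ N (Y.mulVec u) v + B₀ σ N (Y.mulVec u) (Y.mulVec v) = 0 := by
      have := sub_eq_zero.2 h
      rw [← this]; abel
    rw [eq_neg_iff_add_eq_zero, h']
  have h := hexp (Pi.single i.rev 1) (Pi.single j 1)
  rw [Matrix.mulVec_single_one, Matrix.mulVec_single_one, B₀_single_left, B₀_single_right, Fin.rev_rev] at h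
  have hcol : ∀ k l : Fin N, Valued.v (Y.col l k) ≤ Valued.v ϖ ^ d := fun k l => hY k l
  rw [Matrix.col_apply, Matrix.col_apply] at h
  rw [h, Valuation.map_neg, B₀_apply]
  refine Valuation.map_sum_le _ fun k _ => ?_
  rw [map_mul, hvσ]
  exact mul_le_mul' (hcol k i.rev) (hcol k.rev j)

/-- **SYMMETRY AT ODD DEPTH** (any rank `N`): for `Γ ∈ U(σ, J_N)` with `Y = Γ − 1` of level `ϖ^d`, `d` odd (`σϖ = −ϖ`, `σ` residually trivial):
`|Y_{ij} − Y_{rev j, rev i}| ≤ |ϖ|^{d+1}` (rank 3: ★ `v_coe_sub_one_apply_sub_rev_le_of_odd`). [cite: Tits1979, §3.5] [cite: BruhatTits1972, §10] -/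
theorem v_coe_sub_one_apply_sub_rev_le_of_odd_fin {N : ℕ} (hvσ : ∀ z, Valued.v (σ z) = Valued.v z) (hσϖ : σ ϖ = -ϖ) (hϖ : Valued.v ϖ = WithZero.exp (-1 : ℤ))
    (hres : ∀ x : K, Valued.v x ≤ 1 → Valued.v (σ x - x) < 1)
    (γ : unitaryGroupOfForm σ ((StdForm.antidiagonal N).over K)) {d : ℕ} (hd : Odd d)
    (hY : ∀ i j, Valued.v ((((γ : GL (Fin N) K) : Matrix (Fin N) (Fin N) K) - 1) i j) ≤ Valued.v ϖ ^ d) (i j : Fin N) :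
    Valued.v ((((γ : GL (Fin N) K) : Matrix (Fin N) (Fin N) K) - 1) i j - (((γ : GL (Fin N) K) : Matrix (Fin N) (Fin N) K) - 1) j.rev i.rev) ≤ Valued.v ϖ ^ (d + 1) := by
  set Y : Matrix (Fin N) (Fin N) K := ((γ : GL (Fin N) K) : Matrix (Fin N) (Fin N) K) - 1 with hYdef
  have hϖ1 : Valued.v ϖ ≤ 1 := by rw [hϖ, ← WithZero.exp_zero]; exact WithZero.exp_le_exp.2 (by norm_num)
  have hd1 : 1 ≤ d := hd.pos
  have hskew := v_coe_sub_one_apply_add_sigma_rev_le_fin hvσ γ hY i j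
  have hσ' := v_sigma_add_self_le_of_odd hσϖ hϖ hres hd (hY j.rev i.rev)
  have h2d : Valued.v ϖ ^ d * Valued.v ϖ ^ d ≤ Valued.v ϖ ^ (d + 1) := by
    rw [← pow_add]; exact pow_le_pow_right_of_le_one' hϖ1 (by omega)
  have e : Y i j - Y j.rev i.rev = (Y i j + σ (Y j.rev i.rev)) - (σ (Y j.rev i.rev) + Y j.rev i.rev) := by ring
  rw [e]
  exact (Valuation.map_sub _ _ _).trans (max_le (hskew.trans h2d) hσ')

/-- **ANTISYMMETRY AT EVEN DEPTH** (any rank `N`): for `Γ ∈ U(σ, J_N)` with `Y = Γ − 1` of level `ϖ^d`, `d ≥ 1` even: `|Y_{ij} + Y_{rev j, rev i}| ≤ |ϖ|^{d+1}`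
(rank 3: ★ `v_coe_sub_one_apply_add_rev_le_of_even`). [cite: Tits1979, §3.5] [cite: BruhatTits1972, §10] -/
theorem v_coe_sub_one_apply_add_rev_le_of_even_fin {N : ℕ} (hvσ : ∀ z, Valued.v (σ z) = Valued.v z) (hσϖ : σ ϖ = -ϖ) (hϖ : Valued.v ϖ = WithZero.exp (-1 : ℤ))
    (hres : ∀ x : K, Valued.v x ≤ 1 → Valued.v (σ x - x) < 1)
    (γ : unitaryGroupOfForm σ ((StdForm.antidiagonal N).over K)) {d : ℕ} (hd : Even d) (hd1 : 1 ≤ d)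
    (hY : ∀ i j, Valued.v ((((γ : GL (Fin N) K) : Matrix (Fin N) (Fin N) K) - 1) i j) ≤ Valued.v ϖ ^ d) (i j : Fin N) :
    Valued.v ((((γ : GL (Fin N) K) : Matrix (Fin N) (Fin N) K) - 1) i j + (((γ : GL (Fin N) K) : Matrix (Fin N) (Fin N) K) - 1) j.rev i.rev) ≤ Valued.v ϖ ^ (d + 1) := by
  set Y : Matrix (Fin N) (Fin N) K := ((γ : GL (Fin N) K) : Matrix (Fin N) (Fin N) K) - 1 with hYdef
  have hϖ1 : Valued.v ϖ ≤ 1 := by rw [hϖ, ← WithZero.exp_zero]; exact WithZero.exp_le_exp.2 (by norm_num)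
  have hskew := v_coe_sub_one_apply_add_sigma_rev_le_fin hvσ γ hY i j
  have hσ' := v_sigma_sub_self_le_of_even hσϖ hϖ hres hd (hY j.rev i.rev)
  have h2d : Valued.v ϖ ^ d * Valued.v ϖ ^ d ≤ Valued.v ϖ ^ (d + 1) := by
    rw [← pow_add]; exact pow_le_pow_right_of_le_one' hϖ1 (by omega)
  have e : Y i j + Y j.rev i.rev = (Y i j + σ (Y j.rev i.rev)) - (σ (Y j.rev i.rev) - Y j.rev i.rev) := by ring
  rw [e]
  exact (Valuation.map_sub _ _ _).trans (max_le (hskew.trans h2d) hσ')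

omit [Valued K ℤᵐ⁰] in
/-- `κ⁻¹γκ − 1 = κ⁻¹(γ − 1)κ` inside `U(σ, H)` (any form `H`, any rank; rank 3 ∕ `J₀`: ★ `coe_inv_mul_mul_sub_one`). [cite: BruhatTits1972, §10] -/
theorem coe_inv_mul_mul_sub_one_fin {N : ℕ} {H : Matrix (Fin N) (Fin N) K} (γ κ : unitaryGroupOfForm σ H) :
    (((κ⁻¹ * γ * κ : unitaryGroupOfForm σ H) : GL (Fin N) K) : Matrix (Fin N) (Fin N) K) - 1 =
      (((κ : GL (Fin N) K)⁻¹ : GL (Fin N) K) : Matrix (Fin N) (Fin N) K) * ((((γ : GL (Fin N) K) : Matrix (Fin N) (Fin N) K) - 1)) * ((κ : GL (Fin N) K) : Matrix (Fin N) (Fin N) K) := by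
  rw [Matrix.mul_sub, Matrix.sub_mul, Matrix.mul_one, Units.inv_mul, Subgroup.coe_mul, Subgroup.coe_mul, Subgroup.coe_inv, Units.val_mul, Units.val_mul]

/-- **THE CLASS TOKEN AT `u·L₀` IS THE CLASS TOKEN AT `L₀` FOR `u⁻¹γu`** (any form `H`, any rank; `u` unitary: `⟨u x, (γ − 1) u x⟩_H = ⟨x, (u⁻¹γu − 1) x⟩_H`; any
scalar `r`, any constant `t`).  Rank 3 ∕ `J₀`: ★ `exists_mem_mapGL_stdLattice_depthClass_iff`. [cite: BruhatTits1972, §10] [cite: Kottwitz1986, §3] -/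
theorem exists_mem_mapGL_stdLattice_depthClass_iff_fin {N : ℕ} {H : Matrix (Fin N) (Fin N) K} (u γ : unitaryGroupOfForm σ H) (r t : K) :
    (∃ y ∈ mapGL (u : GL (Fin N) K) (stdLattice K N), ∃ a : K, Valued.v a = 1 ∧
        Valued.v (r * pairing σ H y ((((γ : GL (Fin N) K) : Matrix (Fin N) (Fin N) K) - 1) *ᵥ y) - t * a ^ 2) < 1) ↔
      ∃ x ∈ stdLattice K N, ∃ a : K, Valued.v a = 1 ∧
        Valued.v (r * pairing σ H x
          (((((u⁻¹ * γ * u : unitaryGroupOfForm σ H) : GL (Fin N) K) : Matrix (Fin N) (Fin N) K) - 1) *ᵥ x) - t * a ^ 2) < 1 := by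
  have hmat : ∀ x : Fin N → K,
      ((((γ : GL (Fin N) K) : Matrix (Fin N) (Fin N) K) - 1) *ᵥ (((u : GL (Fin N) K) : Matrix (Fin N) (Fin N) K) *ᵥ x)) =
        ((u : GL (Fin N) K) : Matrix (Fin N) (Fin N) K) *ᵥ
          (((((u⁻¹ * γ * u : unitaryGroupOfForm σ H) : GL (Fin N) K) : Matrix (Fin N) (Fin N) K) - 1) *ᵥ x) := by
    intro x
    rw [coe_inv_mul_mul_sub_one_fin, Matrix.mulVec_mulVec, Matrix.mulVec_mulVec, ← Matrix.mul_assoc, ← Matrix.mul_assoc, ← Units.val_mul, mul_inv_cancel,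
      Units.val_one, Matrix.one_mul]
  have hinv : ∀ y : Fin N → K, ((u : GL (Fin N) K) : Matrix (Fin N) (Fin N) K) *ᵥ ((((u : GL (Fin N) K)⁻¹ : GL (Fin N) K) : Matrix (Fin N) (Fin N) K) *ᵥ y) = y :=
    fun y => by rw [Matrix.mulVec_mulVec, ← Units.val_mul, mul_inv_cancel, Units.val_one, Matrix.one_mulVec]
  constructor
  · rintro ⟨y, hy, a, ha, hlt⟩
    rw [mem_mapGL_iff] at hy
    refine ⟨(((u : GL (Fin N) K)⁻¹ : GL (Fin N) K) : Matrix (Fin N) (Fin N) K) *ᵥ y, hy, a, ha, ?_⟩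
    rw [← pairing_mulVec_mulVec_of_mem_unitary u.2, ← hmat, hinv]
    exact hlt
  · rintro ⟨x, hx, a, ha, hlt⟩
    refine ⟨((u : GL (Fin N) K) : Matrix (Fin N) (Fin N) K) *ᵥ x, ?_, a, ha, ?_⟩
    · rw [mem_mapGL_iff, Matrix.mulVec_mulVec, ← Units.val_mul, inv_mul_cancel, Units.val_one, Matrix.one_mulVec]
      exact hx
    · rw [hmat, pairing_mulVec_mulVec_of_mem_unitary u.2]
      exact hlt

end Literature.NumberTheory.Automorphic.UnitaryLatticeTree

end
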